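import Mathlib.Analysis.SpecialFunctions.Gamma.Beta
import Mathlib.MeasureTheory.Function.JacobianOneDim
import Mathlib.Analysis.SpecialFunctions.Trigonometric.DerivHyp
import HarnessLib

/-!
# The Fourier transform of `sech²`: `∫ e^{iyu}/cosh²u du = πy/sinh(πy/2) = 2|Γ(1 + iy/2)|²`

Topic `Literature/Analysis/SpecialFunctions`. The classical cosine transform of the weight
`1/cosh² u` that appears in Ford's zero detector for the Riemann zeta function (K. Ford,
*Zero-free regions for the Riemann zeta function*, Number Theory for the Millennium II (2002),
eq. (5.3): `U(y) := ∫_{-∞}^{∞} e^{iyu}/cosh²u du = πy/sinh(πy/2) ≥ 0`, "which can be proved by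
contour integration"; used in Ford's Lemma 5.1 = Mossinghoff–Trudgian–Yang, Lemma 4.4).

Everything here is PROVED, and without contour integration: the logistic substitution
`x = e^{2u}/(1 + e^{2u})` has `dx = du/(2cosh²u)` and `x/(1 − x) = e^{2u}`, so that
`∫ e^{iyu}/cosh²u du = 2 ∫₀¹ x^{iy/2} (1 − x)^{−iy/2} dx = 2 B(1 + iy/2, 1 − iy/2)`
(Mathlib's `Complex.betaIntegral`), and `B(s, 2 − s) = Γ(s)Γ(2 − s) = Γ(s) Γ(conj s) = |Γ(s)|²`
for `s = 1 + iy/2` (`Complex.Gamma_mul_Gamma_eq_betaIntegral`, `Complex.Gamma_conj`); the closed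
form `πy/sinh(πy/2)` then follows from the reflection formula (`Complex.Gamma_mul_Gamma_one_sub`).

Main statements (`y, φ : ℝ`):

* `integral_cexp_mul_I_div_cosh_sq` : `∫ e^{iyu}/cosh²u du = 2|Γ(1 + iy/2)|²` (as a complex number);
* `integral_cos_mul_div_cosh_sq` : `∫ cos(yu)/cosh²u du = 2|Γ(1 + iy/2)|²`,
  `integral_sin_mul_div_cosh_sq` : `∫ sin(yu)/cosh²u du = 0`,
  `integral_cos_add_mul_div_cosh_sq` : `∫ cos(φ + yu)/cosh²u du = 2|Γ(1 + iy/2)|² cos φ`;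
* `integral_cos_mul_div_cosh_sq_pos`, `integral_cos_mul_div_cosh_sq_le_two`, `integral_inv_cosh_sq`
  (`∫ du/cosh²u = 2`) and the integrability statements;
* `two_mul_norm_Gamma_sq_eq` : `2|Γ(1 + iy/2)|² = πy/sinh(πy/2)` for `y ≠ 0` (Ford's closed form).

## References

* K. Ford, *Zero-free regions for the Riemann zeta function*, in: Number Theory for the Millennium
  II (Urbana, IL, 2000), A K Peters (2002), 25–56 = arXiv:1910.08205, eq. (5.3).
  (`Ford2002Millennium`)
-/

noncomputable section

open Real MeasureTheory Set

namespace Literature.Analysis.SpecialFunctions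

open _root_.Complex hiding exp log cos sin cosh sinh

/-! ## The logistic substitution -/

/-- The logistic substitution `x(u) = e^{2u}/(1 + e^{2u})`, a bijection from `ℝ` onto `(0, 1)`
with `x'(u) = 1/(2cosh²u)` and `x/(1 − x) = e^{2u}`. [folklore] -/
def sigm2 (u : ℝ) : ℝ := Real.exp (2 * u) / (1 + Real.exp (2 * u))

/-- `x(u) > 0`. [folklore] -/
theorem sigm2_pos (u : ℝ) : 0 < sigm2 u := by
  unfold sigm2; positivity

/-- `1 − x(u) = 1/(1 + e^{2u})`. [folklore] -/
theorem one_sub_sigm2 (u : ℝ) : 1 - sigm2 u = 1 / (1 + Real.exp (2 * u)) := by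
  have h : 0 < 1 + Real.exp (2 * u) := by positivity
  unfold sigm2; field_simp; ring

/-- `x(u) < 1`. [folklore] -/
theorem sigm2_lt_one (u : ℝ) : sigm2 u < 1 := by
  have h := one_sub_sigm2 u
  have : 0 < 1 / (1 + Real.exp (2 * u)) := by positivity
  linarith

/-- `x/(1 − x) = e^{2u}`. [folklore] -/
theorem sigm2_div_one_sub (u : ℝ) : sigm2 u / (1 - sigm2 u) = Real.exp (2 * u) := by
  rw [one_sub_sigm2]
  have h : 0 < 1 + Real.exp (2 * u) := by positivity
  unfold sigm2; field_simp

/-- `log x(u) − log(1 − x(u)) = 2u`. [folklore] -/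
theorem log_sigm2_sub_log (u : ℝ) : Real.log (sigm2 u) - Real.log (1 - sigm2 u) = 2 * u := by
  rw [← Real.log_div (sigm2_pos u).ne' (by linarith [sigm2_lt_one u]), sigm2_div_one_sub,
    Real.log_exp]

/-- `x(u)` is injective. [folklore] -/
theorem sigm2_injective : Function.Injective sigm2 := by
  intro u v h
  have hu := log_sigm2_sub_log u
  rw [h, log_sigm2_sub_log v] at hu
  linarith

/-- `x'(u) = 1/(2cosh²u)`. [folklore] -/
theorem hasDerivAt_sigm2 (u : ℝ) : HasDerivAt sigm2 (1 / (2 * Real.cosh u ^ 2)) u := by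
  have hE : HasDerivAt (fun v ↦ Real.exp (2 * v)) (Real.exp (2 * u) * 2) u := by
    have h1 : HasDerivAt (fun v : ℝ ↦ 2 * v) 2 u := by
      simpa using (hasDerivAt_id u).const_mul (2 : ℝ)
    simpa using h1.exp
  have hpos : 0 < 1 + Real.exp (2 * u) := by positivity
  have h := hE.div (hE.const_add 1) hpos.ne'
  refine h.congr_deriv ?_
  have hc : Real.cosh u ^ 2 = (1 + Real.exp (2 * u)) ^ 2 / (4 * Real.exp (2 * u)) := by
    rw [Real.cosh_eq, show (2 : ℝ) * u = u + u by ring, Real.exp_add, Real.exp_neg]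
    have : 0 < Real.exp u := Real.exp_pos u
    field_simp
    ring
  rw [hc]
  have : 0 < Real.exp (2 * u) := Real.exp_pos _
  field_simp
  ring

/-- The image of `ℝ` under `x(u)` is `(0, 1)`. [folklore] -/
theorem image_sigm2_univ : sigm2 '' univ = Ioo 0 1 := by
  ext x
  simp only [image_univ, mem_range, mem_Ioo]
  constructor
  · rintro ⟨u, rfl⟩
    exact ⟨sigm2_pos u, sigm2_lt_one u⟩
  · rintro ⟨h0, h1⟩
    refine ⟨Real.log (x / (1 - x)) / 2, ?_⟩
    have hx : 0 < x / (1 - x) := div_pos h0 (by linarith)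
    unfold sigm2
    rw [show 2 * (Real.log (x / (1 - x)) / 2) = Real.log (x / (1 - x)) by ring, Real.exp_log hx]
    have : (1 - x) ≠ 0 := by linarith
    field_simp
    ring

/-! ## The Beta integrand along the substitution -/

/-- The integrand `x^{s−1}(1 − x)^{t−1}` of Mathlib's `Complex.betaIntegral`. [folklore] -/
def betaIntegrand (s t : ℂ) (x : ℝ) : ℂ := (x : ℂ) ^ (s - 1) * (1 - (x : ℂ)) ^ (t - 1)

/-- `B(s, t) = ∫_{(0,1)} x^{s−1}(1 − x)^{t−1} dx` (Mathlib's interval integral rewritten as a set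
integral over the open interval). [folklore] -/
theorem betaIntegral_eq_setIntegral (s t : ℂ) :
    Complex.betaIntegral s t = ∫ x in Ioo (0 : ℝ) 1, betaIntegrand s t x := by
  rw [Complex.betaIntegral, intervalIntegral.integral_of_le zero_le_one, integral_Ioc_eq_integral_Ioo]
  rfl

/-- Along the substitution the Beta integrand with exponents `±ia` is a pure phase:
`x^{ia}(1 − x)^{−ia} = e^{2iau}` at `x = x(u)`. [folklore] -/
theorem betaIntegrand_sigm2 (a u : ℝ) :
    betaIntegrand (1 + a * I) (1 - a * I) (sigm2 u) = Complex.exp ((2 * a * u : ℝ) * I) := by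
  have h0 := sigm2_pos u
  have h1 := sigm2_lt_one u
  have hx0 : ((sigm2 u : ℝ) : ℂ) ≠ 0 := ofReal_ne_zero.mpr h0.ne'
  have hx1 : (1 - ((sigm2 u : ℝ) : ℂ)) ≠ 0 := by
    rw [show (1 : ℂ) - ((sigm2 u : ℝ) : ℂ) = (((1 - sigm2 u : ℝ)) : ℂ) by push_cast; ring]
    exact ofReal_ne_zero.mpr (by linarith)
  unfold betaIntegrand
  rw [show (1 : ℂ) + a * I - 1 = a * I by ring, show (1 : ℂ) - a * I - 1 = -(a * I) by ring,
    cpow_def_of_ne_zero hx0, cpow_def_of_ne_zero hx1, ← Complex.exp_add,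
    show (1 : ℂ) - ((sigm2 u : ℝ) : ℂ) = (((1 - sigm2 u : ℝ)) : ℂ) by push_cast; ring,
    ← ofReal_log h0.le, ← ofReal_log (by linarith)]
  congr 1
  have h := log_sigm2_sub_log u
  have h' : (Real.log (sigm2 u) : ℂ) - (Real.log (1 - sigm2 u) : ℂ) = ((2 * u : ℝ) : ℂ) := by
    rw [← h]; push_cast; ring
  push_cast at h' ⊢
  linear_combination (a * I) * h'

/-! ## The Fourier transform of `sech²` -/

/-- **Change of variables**: `∫ e^{iyu}/cosh²u du = 2 B(1 + iy/2, 1 − iy/2)`.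
[cite: Ford2002Millennium, (5.3)] -/
theorem integral_cexp_mul_I_div_cosh_sq_eq_betaIntegral (y : ℝ) :
    ∫ u : ℝ, Complex.exp ((y * u : ℝ) * I) / ((Real.cosh u : ℝ) : ℂ) ^ 2 =
      2 * Complex.betaIntegral (1 + (y / 2 : ℝ) * I) (1 - (y / 2 : ℝ) * I) := by
  have hcv := integral_image_eq_integral_abs_deriv_smul MeasurableSet.univ
    (fun u _ ↦ (hasDerivAt_sigm2 u).hasDerivWithinAt) sigm2_injective.injOn
    (betaIntegrand (1 + (y / 2 : ℝ) * I) (1 - (y / 2 : ℝ) * I))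
  rw [image_sigm2_univ, Measure.restrict_univ] at hcv
  rw [betaIntegral_eq_setIntegral, hcv, ← integral_const_mul]
  refine integral_congr_ae (ae_of_all _ fun u ↦ ?_)
  have hc : 0 < Real.cosh u := Real.cosh_pos u
  dsimp only
  rw [betaIntegrand_sigm2, abs_of_pos (by positivity), Complex.real_smul,
    show 2 * (y / 2) * u = y * u by ring]
  have hc' : ((Real.cosh u : ℝ) : ℂ) ≠ 0 := ofReal_ne_zero.mpr hc.ne'
  push_cast
  field_simp

/-- `B(1 + ia, 1 − ia) = Γ(1 + ia) Γ(1 − ia) = |Γ(1 + ia)|²`. [folklore] -/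
theorem betaIntegral_one_add_one_sub (a : ℝ) :
    Complex.betaIntegral (1 + a * I) (1 - a * I) = ((‖Complex.Gamma (1 + a * I)‖ ^ 2 : ℝ) : ℂ) := by
  have hs : 0 < (1 + (a : ℂ) * I).re := by simp
  have ht : 0 < (1 - (a : ℂ) * I).re := by simp
  have h := Complex.Gamma_mul_Gamma_eq_betaIntegral hs ht
  rw [show (1 : ℂ) + a * I + (1 - a * I) = 1 + 1 by ring, Complex.Gamma_add_one 1 one_ne_zero,
    Complex.Gamma_one, one_mul, one_mul] at h
  rw [← h]
  have hconj : (1 : ℂ) - a * I = (starRingEnd ℂ) (1 + a * I) := by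
    apply Complex.ext <;> simp
  rw [hconj, Complex.Gamma_conj, Complex.mul_conj, Complex.normSq_eq_norm_sq]

/-- **Ford's `U(y)`, Gamma form**: `∫ e^{iyu}/cosh²u du = 2|Γ(1 + iy/2)|²`.
[cite: Ford2002Millennium, (5.3)] -/
theorem integral_cexp_mul_I_div_cosh_sq (y : ℝ) :
    ∫ u : ℝ, Complex.exp ((y * u : ℝ) * I) / ((Real.cosh u : ℝ) : ℂ) ^ 2 =
      ((2 * ‖Complex.Gamma (1 + (y / 2 : ℝ) * I)‖ ^ 2 : ℝ) : ℂ) := by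
  rw [integral_cexp_mul_I_div_cosh_sq_eq_betaIntegral, betaIntegral_one_add_one_sub]
  push_cast
  ring

/-- The integrand `e^{iyu}/cosh²u` is integrable on `ℝ`. [folklore] -/
theorem integrable_cexp_mul_I_div_cosh_sq (y : ℝ) :
    Integrable fun u : ℝ ↦ Complex.exp ((y * u : ℝ) * I) / ((Real.cosh u : ℝ) : ℂ) ^ 2 := by
  set s : ℂ := 1 + (y / 2 : ℝ) * I
  set t : ℂ := 1 - (y / 2 : ℝ) * I
  have hs : 0 < s.re := by simp [s]
  have ht : 0 < t.re := by simp [t]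
  have hG : IntegrableOn (betaIntegrand s t) (sigm2 '' univ) := by
    rw [image_sigm2_univ]
    have h := (intervalIntegrable_iff_integrableOn_Ioc_of_le zero_le_one).1
      (Complex.betaIntegral_convergent hs ht)
    exact h.mono_set Ioo_subset_Ioc_self
  have h2 := (integrableOn_image_iff_integrableOn_abs_deriv_smul MeasurableSet.univ
    (fun u _ ↦ (hasDerivAt_sigm2 u).hasDerivWithinAt) sigm2_injective.injOn (betaIntegrand s t)).1 hG
  rw [integrableOn_univ] at h2
  have h3 := h2.const_mul (2 : ℂ)
  refine h3.congr (ae_of_all _ fun u ↦ ?_)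
  have hc : 0 < Real.cosh u := Real.cosh_pos u
  simp only [s, t]
  rw [betaIntegrand_sigm2, abs_of_pos (by positivity), Complex.real_smul,
    show 2 * (y / 2) * u = y * u by ring]
  have hc' : ((Real.cosh u : ℝ) : ℂ) ≠ 0 := ofReal_ne_zero.mpr hc.ne'
  push_cast
  field_simp

/-- `cos(yu)/cosh²u` is integrable on `ℝ`. [folklore] -/
theorem integrable_cos_mul_div_cosh_sq (y : ℝ) :
    Integrable fun u : ℝ ↦ Real.cos (y * u) / Real.cosh u ^ 2 := by
  have h := (integrable_cexp_mul_I_div_cosh_sq y).re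
  refine h.congr (ae_of_all _ fun u ↦ ?_)
  simp only [RCLike.re_to_complex]
  rw [← Complex.ofReal_pow, Complex.div_ofReal_re, Complex.exp_ofReal_mul_I_re]

/-- `sin(yu)/cosh²u` is integrable on `ℝ`. [folklore] -/
theorem integrable_sin_mul_div_cosh_sq (y : ℝ) :
    Integrable fun u : ℝ ↦ Real.sin (y * u) / Real.cosh u ^ 2 := by
  have h := (integrable_cexp_mul_I_div_cosh_sq y).im
  refine h.congr (ae_of_all _ fun u ↦ ?_)
  simp only [RCLike.im_to_complex]
  rw [← Complex.ofReal_pow, Complex.div_ofReal_im, Complex.exp_ofReal_mul_I_im]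

/-- `1/cosh²u` is integrable on `ℝ`. [folklore] -/
theorem integrable_inv_cosh_sq : Integrable fun u : ℝ ↦ 1 / Real.cosh u ^ 2 := by
  simpa using integrable_cos_mul_div_cosh_sq 0

/-- **Ford's `U(y)`, real form**: `∫ cos(yu)/cosh²u du = 2|Γ(1 + iy/2)|²`.
[cite: Ford2002Millennium, (5.3)] -/
theorem integral_cos_mul_div_cosh_sq (y : ℝ) :
    ∫ u : ℝ, Real.cos (y * u) / Real.cosh u ^ 2 = 2 * ‖Complex.Gamma (1 + (y / 2 : ℝ) * I)‖ ^ 2 := by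
  have h := integral_re (integrable_cexp_mul_I_div_cosh_sq y)
  rw [integral_cexp_mul_I_div_cosh_sq] at h
  simp only [RCLike.re_to_complex, Complex.ofReal_re] at h
  rw [← h]
  refine integral_congr_ae (ae_of_all _ fun u ↦ ?_)
  dsimp only
  rw [← Complex.ofReal_pow, Complex.div_ofReal_re, Complex.exp_ofReal_mul_I_re]

/-- `∫ sin(yu)/cosh²u du = 0`. [folklore] -/
theorem integral_sin_mul_div_cosh_sq (y : ℝ) :
    ∫ u : ℝ, Real.sin (y * u) / Real.cosh u ^ 2 = 0 := by
  have h := integral_im (integrable_cexp_mul_I_div_cosh_sq y)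
  rw [integral_cexp_mul_I_div_cosh_sq] at h
  simp only [RCLike.im_to_complex, Complex.ofReal_im] at h
  rw [← h]
  refine integral_congr_ae (ae_of_all _ fun u ↦ ?_)
  dsimp only
  rw [← Complex.ofReal_pow, Complex.div_ofReal_im, Complex.exp_ofReal_mul_I_im]

/-- `∫ du/cosh²u = 2`. [folklore] -/
theorem integral_inv_cosh_sq : ∫ u : ℝ, 1 / Real.cosh u ^ 2 = 2 := by
  have h := integral_cos_mul_div_cosh_sq 0
  simp only [zero_mul, Real.cos_zero, zero_div, Complex.ofReal_zero, add_zero,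
    Complex.Gamma_one, norm_one, one_pow, mul_one] at h
  exact h

/-- **`U(y) > 0`**. [cite: Ford2002Millennium, (5.3)] -/
theorem integral_cos_mul_div_cosh_sq_pos (y : ℝ) :
    0 < ∫ u : ℝ, Real.cos (y * u) / Real.cosh u ^ 2 := by
  rw [integral_cos_mul_div_cosh_sq]
  have h : Complex.Gamma (1 + (y / 2 : ℝ) * I) ≠ 0 := by
    refine Complex.Gamma_ne_zero fun m hm ↦ ?_
    have := congrArg Complex.re hm
    simp at this
    linarith
  positivity

/-- `U(y) ≥ 0`. [cite: Ford2002Millennium, (5.3)] -/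
theorem integral_cos_mul_div_cosh_sq_nonneg (y : ℝ) :
    0 ≤ ∫ u : ℝ, Real.cos (y * u) / Real.cosh u ^ 2 :=
  (integral_cos_mul_div_cosh_sq_pos y).le

/-- **`U(y) ≤ 2`** (`cos ≤ 1` and `∫ du/cosh²u = 2`). [cite: Ford2002Millennium, proof of Lemma 5.1] -/
theorem integral_cos_mul_div_cosh_sq_le_two (y : ℝ) :
    ∫ u : ℝ, Real.cos (y * u) / Real.cosh u ^ 2 ≤ 2 := by
  rw [← integral_inv_cosh_sq]
  refine integral_mono (integrable_cos_mul_div_cosh_sq y) integrable_inv_cosh_sq fun u ↦ ?_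
  have hc : 0 < Real.cosh u ^ 2 := by positivity
  exact div_le_div_of_nonneg_right (Real.cos_le_one _) hc.le

/-- **Shifted cosine transform**: `∫ cos(φ + yu)/cosh²u du = 2|Γ(1 + iy/2)|² cos φ`.
[cite: Ford2002Millennium, proof of Lemma 5.1] -/
theorem integral_cos_add_mul_div_cosh_sq (φ y : ℝ) :
    ∫ u : ℝ, Real.cos (φ + y * u) / Real.cosh u ^ 2 =
      2 * ‖Complex.Gamma (1 + (y / 2 : ℝ) * I)‖ ^ 2 * Real.cos φ := by
  have h1 := integrable_cos_mul_div_cosh_sq y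
  have h2 := integrable_sin_mul_div_cosh_sq y
  have e : (fun u : ℝ ↦ Real.cos (φ + y * u) / Real.cosh u ^ 2) =
      fun u ↦ Real.cos φ * (Real.cos (y * u) / Real.cosh u ^ 2)
        - Real.sin φ * (Real.sin (y * u) / Real.cosh u ^ 2) := by
    funext u; rw [Real.cos_add]; ring
  rw [e, integral_sub (h1.const_mul _) (h2.const_mul _), integral_const_mul, integral_const_mul,
    integral_cos_mul_div_cosh_sq, integral_sin_mul_div_cosh_sq]
  ring

/-- **Ford's closed form**: `2|Γ(1 + iy/2)|² = πy/sinh(πy/2)` for `y ≠ 0` (reflection formula).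
[cite: Ford2002Millennium, (5.3)] -/
theorem two_mul_norm_Gamma_sq_eq {y : ℝ} (hy : y ≠ 0) :
    2 * ‖Complex.Gamma (1 + (y / 2 : ℝ) * I)‖ ^ 2 = π * y / Real.sinh (π * y / 2) := by
  set a : ℝ := y / 2 with ha
  have ha0 : a ≠ 0 := by simp [ha, hy]
  have hsh : Real.sinh (π * a) ≠ 0 := by
    intro h
    rw [Real.sinh_eq_zero] at h
    exact mul_ne_zero Real.pi_ne_zero ha0 h
  -- `|Γ(1 + ia)|² = Γ(1 + ia) Γ(1 − ia) = ia Γ(ia) Γ(1 − ia) = ia π / sin(π i a)`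
  have hC : (((‖Complex.Gamma (1 + a * I)‖ ^ 2 : ℝ)) : ℂ) = ((π * a / Real.sinh (π * a) : ℝ) : ℂ) := by
    rw [← betaIntegral_one_add_one_sub]
    have hs : 0 < (1 + (a : ℂ) * I).re := by simp
    have ht : 0 < (1 - (a : ℂ) * I).re := by simp
    have h := Complex.Gamma_mul_Gamma_eq_betaIntegral hs ht
    rw [show (1 : ℂ) + a * I + (1 - a * I) = 1 + 1 by ring, Complex.Gamma_add_one 1 one_ne_zero,
      Complex.Gamma_one, one_mul, one_mul] at h
    rw [← h, show (1 : ℂ) + a * I = a * I + 1 by ring,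
      Complex.Gamma_add_one _ (mul_ne_zero (ofReal_ne_zero.mpr ha0) I_ne_zero), mul_assoc,
      show (1 : ℂ) - a * I = 1 - (a * I) by ring, Complex.Gamma_mul_Gamma_one_sub,
      show (π : ℂ) * (a * I) = ((π * a : ℝ) : ℂ) * I by push_cast; ring, Complex.sin_mul_I,
      ← Complex.ofReal_sinh]
    have hsh' : ((Real.sinh (π * a) : ℝ) : ℂ) ≠ 0 := ofReal_ne_zero.mpr hsh
    push_cast
    field_simp
  have hR := congrArg Complex.re hC
  simp only [Complex.ofReal_re] at hR
  have hsh2 : Real.sinh (π * y / 2) ≠ 0 := by rwa [show π * y / 2 = π * a by rw [ha]; ring]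
  rw [hR, show π * a = π * y / 2 by rw [ha]; ring]
  field_simp

end Literature.Analysis.SpecialFunctions
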